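import Summits.BirchSwinnertonDyer.BirchSwinnertonDyer.Theorems.ErratumRoadFiveEulerHalfNotRamInertUpToOneSharpTwo
import Summits.BirchSwinnertonDyer.BirchSwinnertonDyer.Theorems.ErratumRoadFiveEulerHalfNotRamLevelLoweringCut
import HarnessLib

/-!
# Route `ErratumRoadFive` (K2, `p ≥ 5`), crux `EulerHalfNotRamNoInertSetAtFive` (item stmt-BirchSwinnertonDyer-19715), line `birth` v10 → v11 (LEAD g1's revision):
# GLUE in v10's `2`-relaxed currency — S2b from the inert₂ road, the up-to-one₂♯ road and the AFTER-CUTS residual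
# «no genus-zero additive locus, `p` a self-carrier, three offending split carriers ≡ 1 (mod p)» (cell `bsd-stepL`, width seat `bsd-line-er5-p1-w2` g1;
# `--supports stmt-BirchSwinnertonDyer-19715 --as helper`)

WHY. Plan g40 registered v10 (this seat's turnkey, tree 7fd4823d36ab; data roads in the `2`-relaxed currency `∀ q ∈ R, ¬ p ∣ q − 1`) and asked the LEAD
`bsd-line-er5-p1` g1 to build v11 ON TOP OF v10 with its level-lowering cut (RULING 58: residual ↦ «after-cuts», + one citable stub {`diamond1995_refinedSerre`,
Ogg–Saito}). The LEAD's landed files are in v9's currency (`…Exhaustion.lean` p624772: half `q ≠ 2 ∧ ¬ p ∣ q − 1`) resp. currency-free (`…LevelLoweringCut.lean`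
p625249: `EulerHalfLevelLoweringCut.not_dvd_ordp_of_genusZeroAdditive_of_not_ram` — on 19715's locus, if the additive conductor is `1, 4, 8, 16, 9` or `25` then
`p ∤ ord_p Δ_min`). THIS FILE is the one theorem v11-on-v10 needs: p625927 §4 with the semistable cut REPLACED by the LEAD's genus-zero cut.
* `res_otherMultNoSplitDatumAtFive_of_inert₂_of_upToOne₂Sharp_of_afterCuts (hnf hLL hOS) hI₂ hU₂ hC3₄` — v9's S2b shape (`Statement.stub_res_otherMultNoSplitDatumAtFive`)
  VERBATIM as conclusion, by cases: inert₂ datum → `hI₂` (p609923's ∀-form); up-to-one₂♯ datum → `hU₂` (p625927 §1's ∀-form); otherwise `p ∣ ord_p Δ_min`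
  (p625927 §2), hence NOT on a genus-zero additive locus (LEAD's cut, from modularity + `diamond1995_refinedSerre` + Ogg–Saito), and three distinct offending split
  carriers `≡ 1 (mod p)` (p625102) — the v11 RESIDUAL `hC3₄` = v10's `stub_res_otherMultThreeOneModOffendingAtFive` PLUS «¬(genus-zero additive locus)» PLUS
  `p ∣ ord_p Δ_min`, with «no up-to-one₂ datum» in the ♯ form. v10's residual implies it (drop the two extra hypotheses; an up-to-one₂ datum is a ♯ one).
Recipe for v11 (LEAD's act): `res_otherMultNoSplitDatumAtFive_of_roads` := this theorem with `hI₂ := Theorems.eulerHalfNotRam_of_inertSetDatum₂ … (hHKi from items)`,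
`hU₂ := EulerHalfInertUpToOne.res_otherMultUpToOne₂SharpAtFive_of_savedDisplayD_of_lowerX11a … (SAV derived from the carrier-labels stub)`, `hnf := h₅`.8,
`hLL ∕ hOS :=` the new citable stub's conjuncts, `hC3₄ :=` the re-typed residual stub.

HONEST FRAMING: THEOREMS ONLY (pure logic over landed lemmas; no definition, no named fact, no `sorry`); CONDITIONAL on every displayed binder (two printed facts by
name + Ogg–Saito by name, the two ∀-roads, the residual); nothing booked; no stub or item closes by this file; 19715 OPEN; BSD is proved for no curve; no summit
statement touched. Credit: LEAD er5-p1 g1 (p625249, the cut), bsd-idea-9 g3 (idea «level-lowering cut»), -w2 g0∕g1 (₂ roads).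
References (locators only): [cite: Ribet1990, Thm. 1.1] [cite: Diamond1995RefinedSerre, Thm. 1.1] [cite: PastenShimura2024, §6.6, Lemmas 6.15, 6.18]
[cite: Jetchev2008, Conj. 1.2].
-/

set_option autoImplicit false
set_option linter.dupNamespace false

noncomputable section

open scoped Classical

open WeierstrassCurve Literature.NumberTheory.EllipticCurves Literature.NumberTheory.EllipticCurves.Rank1Residual
  Literature.NumberTheory.EllipticCurves.ModularForms Literature.NumberTheory.Automorphic
  Literature.NumberTheory.EllipticCurves.Rank1Residual.Typed Summit.BirchSwinnertonDyer.Rank1Residual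
  Summit.BirchSwinnertonDyer.Rank1Residual.X11b

namespace Summit.BirchSwinnertonDyer.BirchSwinnertonDyer.Theorems.EulerHalfInertUpToOne

/-- **S2b of line `birth` (`Statement.stub_res_otherMultNoSplitDatumAtFive`) VERBATIM as conclusion, BY CASES, with the LEAD's genus-zero after-cuts residual:**
inert₂ datum → `hI₂`; up-to-one₂♯ datum → `hU₂`; otherwise `p ∣ ord_p Δ_min` (p625927 §2), hence NOT on a genus-zero additive locus
(`EulerHalfLevelLoweringCut.not_dvd_ordp_of_genusZeroAdditive_of_not_ram`, from `exists_isNewformOf` + `diamond1995_refinedSerre` + Ogg–Saito), and three distinct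
offending split carriers `≡ 1 (mod p)` (p625102) — the v11 RESIDUAL `hC3₄`. Pure logic; CONDITIONAL on the binders; nothing booked.
[cite: Ribet1990, Thm. 1.1] [cite: Diamond1995RefinedSerre, Thm. 1.1] [cite: PastenShimura2024, Lemma 6.18] -/
theorem res_otherMultNoSplitDatumAtFive_of_inert₂_of_upToOne₂Sharp_of_afterCuts
    (hnf : exists_isNewformOf) (hLL : diamond1995_refinedSerre)
    (hOS : ∀ (W : WeierstrassCurve ℚ) (ℓ : ℕ) [Fact ℓ.Prime], W.artinConductorExponent_tate_eq_conductorExponent_of_isElliptic ℓ)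
    (hI₂ : ∀ (W : WeierstrassCurve ℚ) [W.IsElliptic] [W.IsGloballyMinimal] (p : ℕ) [Fact p.Prime],
      ClassX11b W p → 5 ≤ p → Surj W p → ¬ Ram W p →
        (∃ S : Finset ℕ, (∀ ℓ ∈ S, ∃ _ : Fact ℓ.Prime, Mult W ℓ) ∧ Even S.card ∧ p ∈ S ∧
          (∀ (ℓ : ℕ) [Fact ℓ.Prime], ℓ ∉ S → W.HasSplitMultiplicativeReductionAtPrime ℓ →
            ¬ p ∣ padicValInt ℓ W.minimalDiscriminantInt) ∧
          (¬ p ∣ padicValInt p W.minimalDiscriminantInt ∨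
            ∃ R ⊆ S, S.card = 2 * R.card ∧ ∀ q ∈ R, ¬ p ∣ q - 1)) →
          Typed.MissingUpperBoundAt W p)
    (hU₂ : ∀ (W : WeierstrassCurve ℚ) [W.IsElliptic] [W.IsGloballyMinimal] (p : ℕ) [Fact p.Prime],
      ClassX11b W p → 5 ≤ p → Surj W p → ¬ Ram W p →
      (∃ (q₁ : ℕ) (_ : Fact q₁.Prime) (S : Finset ℕ), W.HasSplitMultiplicativeReductionAtPrime q₁ ∧
        p ∣ padicValInt q₁ W.minimalDiscriminantInt ∧
        (∀ ℓ ∈ S, ∃ _ : Fact ℓ.Prime, Mult W ℓ) ∧ Even S.card ∧ p ∈ S ∧ q₁ ∉ S ∧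
        (∀ (ℓ : ℕ) [Fact ℓ.Prime], ℓ ∉ S → ℓ ≠ q₁ → W.HasSplitMultiplicativeReductionAtPrime ℓ →
          ¬ p ∣ padicValInt ℓ W.minimalDiscriminantInt) ∧
        (¬ p ∣ padicValInt p W.minimalDiscriminantInt ∨
          ∃ R ⊆ S, S.card = 2 * R.card ∧ ∀ q ∈ R, ¬ p ∣ q - 1)) →
      Typed.MissingUpperBoundAt W p)
    (hC3₃ : ∀ (W : WeierstrassCurve ℚ) [W.IsElliptic] [W.IsGloballyMinimal] (p : ℕ) [Fact p.Prime],
      ClassX11b W p → 5 ≤ p → Surj W p → ¬ Ram W p → p ∣ W.tamagawaProduct →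
      (∃ ℓ : ℕ, ∃ _ : Fact ℓ.Prime, ℓ ≠ p ∧ W.HasMultiplicativeReductionAtPrime ℓ) →
      ¬ (((∀ (ℓ : ℕ) [Fact ℓ.Prime], ℓ ≠ 2 → W.HasGoodReductionAtPrime ℓ ∨ W.HasMultiplicativeReductionAtPrime ℓ) ∧
          ¬ 2 ^ 5 ∣ W.conductorNorm ℤ) ∨
        ((∀ (ℓ : ℕ) [Fact ℓ.Prime], ℓ ≠ 3 → W.HasGoodReductionAtPrime ℓ ∨ W.HasMultiplicativeReductionAtPrime ℓ) ∧
          ¬ 3 ^ 3 ∣ W.conductorNorm ℤ) ∨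
        ((∀ (ℓ : ℕ) [Fact ℓ.Prime], ℓ ≠ 5 → W.HasGoodReductionAtPrime ℓ ∨ W.HasMultiplicativeReductionAtPrime ℓ) ∧
          ¬ 5 ^ 3 ∣ W.conductorNorm ℤ)) →
      p ∣ padicValInt p W.minimalDiscriminantInt →
      (∃ (q₁ q₂ q₃ : ℕ) (_ : Fact q₁.Prime) (_ : Fact q₂.Prime) (_ : Fact q₃.Prime),
        q₁ ≠ p ∧ q₂ ≠ p ∧ q₃ ≠ p ∧ q₁ ≠ q₂ ∧ q₁ ≠ q₃ ∧ q₂ ≠ q₃ ∧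
        (W.HasSplitMultiplicativeReductionAtPrime q₁ ∧ p ∣ padicValInt q₁ W.minimalDiscriminantInt ∧ p ∣ q₁ - 1) ∧
        (W.HasSplitMultiplicativeReductionAtPrime q₂ ∧ p ∣ padicValInt q₂ W.minimalDiscriminantInt ∧ p ∣ q₂ - 1) ∧
        (W.HasSplitMultiplicativeReductionAtPrime q₃ ∧ p ∣ padicValInt q₃ W.minimalDiscriminantInt ∧ p ∣ q₃ - 1)) →
      ¬ (∃ S : Finset ℕ, (∀ ℓ ∈ S, ∃ _ : Fact ℓ.Prime, Mult W ℓ) ∧ Even S.card ∧ p ∈ S ∧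
          (∀ (ℓ : ℕ) [Fact ℓ.Prime], ℓ ∉ S → W.HasSplitMultiplicativeReductionAtPrime ℓ →
            ¬ p ∣ padicValInt ℓ W.minimalDiscriminantInt) ∧
          (¬ p ∣ padicValInt p W.minimalDiscriminantInt ∨
            ∃ R ⊆ S, S.card = 2 * R.card ∧ ∀ q ∈ R, ¬ p ∣ q - 1)) →
      ¬ (∃ S : Finset ℕ, (∀ ℓ ∈ S, ∃ _ : Fact ℓ.Prime, Mult W ℓ) ∧ Even S.card ∧ p ∉ S ∧
          (∀ (ℓ : ℕ) [Fact ℓ.Prime], ℓ ∉ S → W.HasSplitMultiplicativeReductionAtPrime ℓ →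
            ¬ p ∣ padicValInt ℓ W.minimalDiscriminantInt) ∧
          ((∃ (ℓ₀ : ℕ) (_ : Fact ℓ₀.Prime), Mult W ℓ₀ ∧ ℓ₀ ≠ p ∧ ¬ p ∣ padicValInt ℓ₀ W.minimalDiscriminantInt) ∨
            ∃ R ⊆ S, S.card = 2 * R.card ∧ ∀ q ∈ R, ¬ p ∣ q - 1)) →
      ¬ (∃ (q₁ : ℕ) (_ : Fact q₁.Prime) (S : Finset ℕ), W.HasSplitMultiplicativeReductionAtPrime q₁ ∧
          p ∣ padicValInt q₁ W.minimalDiscriminantInt ∧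
          (∀ ℓ ∈ S, ∃ _ : Fact ℓ.Prime, Mult W ℓ) ∧ Even S.card ∧ p ∈ S ∧ q₁ ∉ S ∧
          (∀ (ℓ : ℕ) [Fact ℓ.Prime], ℓ ∉ S → ℓ ≠ q₁ → W.HasSplitMultiplicativeReductionAtPrime ℓ →
            ¬ p ∣ padicValInt ℓ W.minimalDiscriminantInt) ∧
          (¬ p ∣ padicValInt p W.minimalDiscriminantInt ∨
            ∃ R ⊆ S, S.card = 2 * R.card ∧ ∀ q ∈ R, ¬ p ∣ q - 1)) →
      Typed.MissingUpperBoundAt W p) :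
    ∀ (W : WeierstrassCurve ℚ) [W.IsElliptic] [W.IsGloballyMinimal] (p : ℕ) [Fact p.Prime],
      ClassX11b W p → 5 ≤ p → Surj W p → ¬ Ram W p → p ∣ W.tamagawaProduct →
      (∃ ℓ : ℕ, ∃ _ : Fact ℓ.Prime, ℓ ≠ p ∧ W.HasMultiplicativeReductionAtPrime ℓ) →
      ¬ (∃ S : Finset ℕ, (∀ ℓ ∈ S, ∃ _ : Fact ℓ.Prime, Mult W ℓ) ∧ Even S.card ∧ p ∈ S ∧
          (∀ (ℓ : ℕ) [Fact ℓ.Prime], ℓ ∉ S → W.HasSplitMultiplicativeReductionAtPrime ℓ →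
            ¬ p ∣ padicValInt ℓ W.minimalDiscriminantInt) ∧
          (¬ p ∣ padicValInt p W.minimalDiscriminantInt ∨
            ∃ R ⊆ S, S.card = 2 * R.card ∧ ∀ q ∈ R, q ≠ 2 ∧ ¬ p ∣ q - 1)) →
      ¬ (∃ S : Finset ℕ, (∀ ℓ ∈ S, ∃ _ : Fact ℓ.Prime, Mult W ℓ) ∧ Even S.card ∧ p ∉ S ∧
          (∀ (ℓ : ℕ) [Fact ℓ.Prime], ℓ ∉ S → W.HasSplitMultiplicativeReductionAtPrime ℓ →
            ¬ p ∣ padicValInt ℓ W.minimalDiscriminantInt) ∧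
          ((∃ (ℓ₀ : ℕ) (_ : Fact ℓ₀.Prime), Mult W ℓ₀ ∧ ℓ₀ ≠ p ∧ ¬ p ∣ padicValInt ℓ₀ W.minimalDiscriminantInt) ∨
            ∃ R ⊆ S, S.card = 2 * R.card ∧ ∀ q ∈ R, ¬ p ∣ q - 1)) →
      Typed.MissingUpperBoundAt W p := by
  intro W _ _ p _ hX hp5 hsurj hnram htam hother _hnoI hnoD
  by_cases hI : ∃ S : Finset ℕ, (∀ ℓ ∈ S, ∃ _ : Fact ℓ.Prime, Mult W ℓ) ∧ Even S.card ∧ p ∈ S ∧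
      (∀ (ℓ : ℕ) [Fact ℓ.Prime], ℓ ∉ S → W.HasSplitMultiplicativeReductionAtPrime ℓ →
        ¬ p ∣ padicValInt ℓ W.minimalDiscriminantInt) ∧
      (¬ p ∣ padicValInt p W.minimalDiscriminantInt ∨
        ∃ R ⊆ S, S.card = 2 * R.card ∧ ∀ q ∈ R, ¬ p ∣ q - 1)
  · exact hI₂ W p hX hp5 hsurj hnram hI
  by_cases hU : ∃ (q₁ : ℕ) (_ : Fact q₁.Prime) (S : Finset ℕ), W.HasSplitMultiplicativeReductionAtPrime q₁ ∧
      p ∣ padicValInt q₁ W.minimalDiscriminantInt ∧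
      (∀ ℓ ∈ S, ∃ _ : Fact ℓ.Prime, Mult W ℓ) ∧ Even S.card ∧ p ∈ S ∧ q₁ ∉ S ∧
      (∀ (ℓ : ℕ) [Fact ℓ.Prime], ℓ ∉ S → ℓ ≠ q₁ → W.HasSplitMultiplicativeReductionAtPrime ℓ →
        ¬ p ∣ padicValInt ℓ W.minimalDiscriminantInt) ∧
      (¬ p ∣ padicValInt p W.minimalDiscriminantInt ∨
        ∃ R ⊆ S, S.card = 2 * R.card ∧ ∀ q ∈ R, ¬ p ∣ q - 1)
  · exact hU₂ W p hX hp5 hsurj hnram hU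
  -- no datum: `p` is a self-carrier (p625927 §2), hence `E` lies on none of the genus-zero additive loci (LEAD g1's cut p625249)
  have hpd : p ∣ padicValInt p W.minimalDiscriminantInt := by
    by_contra hW
    rcases inertDatum₂_or_upToOneSharpDatum₂_of_not_dvd_ordp W p hp5 hX.2.2.1 hother hW with hI' | hU'
    · exact hI hI'
    · exact hU hU'
  have hns : ¬ (((∀ (ℓ : ℕ) [Fact ℓ.Prime], ℓ ≠ 2 → W.HasGoodReductionAtPrime ℓ ∨ W.HasMultiplicativeReductionAtPrime ℓ) ∧
          ¬ 2 ^ 5 ∣ W.conductorNorm ℤ) ∨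
        ((∀ (ℓ : ℕ) [Fact ℓ.Prime], ℓ ≠ 3 → W.HasGoodReductionAtPrime ℓ ∨ W.HasMultiplicativeReductionAtPrime ℓ) ∧
          ¬ 3 ^ 3 ∣ W.conductorNorm ℤ) ∨
        ((∀ (ℓ : ℕ) [Fact ℓ.Prime], ℓ ≠ 5 → W.HasGoodReductionAtPrime ℓ ∨ W.HasMultiplicativeReductionAtPrime ℓ) ∧
          ¬ 5 ^ 3 ∣ W.conductorNorm ℤ)) := fun hloc ↦
    EulerHalfLevelLoweringCut.not_dvd_ordp_of_genusZeroAdditive_of_not_ram hnf hLL hOS W p hp5 hX.2.2.1 hX.2.2.2 hnram hloc hpd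
  by_cases h3 : ∃ (q₁ q₂ q₃ : ℕ) (_ : Fact q₁.Prime) (_ : Fact q₂.Prime) (_ : Fact q₃.Prime),
      q₁ ≠ p ∧ q₂ ≠ p ∧ q₃ ≠ p ∧ q₁ ≠ q₂ ∧ q₁ ≠ q₃ ∧ q₂ ≠ q₃ ∧
      (W.HasSplitMultiplicativeReductionAtPrime q₁ ∧ p ∣ padicValInt q₁ W.minimalDiscriminantInt ∧ p ∣ q₁ - 1) ∧
      (W.HasSplitMultiplicativeReductionAtPrime q₂ ∧ p ∣ padicValInt q₂ W.minimalDiscriminantInt ∧ p ∣ q₂ - 1) ∧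
      (W.HasSplitMultiplicativeReductionAtPrime q₃ ∧ p ∣ padicValInt q₃ W.minimalDiscriminantInt ∧ p ∣ q₃ - 1)
  · exact hC3₃ W p hX hp5 hsurj hnram htam hother hns hpd h3 hI hnoD hU
  · rcases inertDatum₂_or_upToOneDatum₂_of_not_threeOneModOffending W p hp5 hX.2.2.1 hother h3 with
      hI' | ⟨q₁, hF₁, S, hs₁, hd₁, hSm, hSe, hpS, hq₁S, hFC, hR⟩
    · exact absurd hI' hI
    · exact absurd ⟨q₁, hF₁, S, hs₁, hd₁, hSm, hSe, hpS, hq₁S, hFC, Or.inr hR⟩ hU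


end Summit.BirchSwinnertonDyer.BirchSwinnertonDyer.Theorems.EulerHalfInertUpToOne

end
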